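import Summits.Ventures.CertifiedManyBodySolver.Certificates.HubbardSquare_kdwidth_M19_v113_r1Av4_T1
import Summits.Ventures.CertifiedManyBodySolver.Certificates.HubbardSquare_kdwidth_M19_v113_r1Av4_T2
import Summits.Ventures.CertifiedManyBodySolver.Certificates.HubbardSquare_kdwidth_M19_v113_r1Av4_T3
import Summits.Ventures.CertifiedManyBodySolver.Certificates.HubbardSquare_kdwidth_M19_v113_r1Av4_T4
import Summits.Ventures.CertifiedManyBodySolver.Certificates.HubbardSquare_cellword_Hg1201E_M19P10W_t40_35_H
import HarnessLib

/-!
# Ventures/CertifiedManyBodySolver — Certificates/HubbardSquare_kdwidth_M19_v113_r1Av4_H14.lean (hubbard-box-p2 g22: KD-WIDTH v4 M19_v113_r1Av4, bridging lemmas part 14 of 14)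

Per-word bridging: each cited landed word (its premises supplied from the bundle `kdw_M19_v113_r1Av4_Premises`) ⇒ `WordRec.Holds e₀` of its
record in `HubbardSquare_kdwidth_M19_v113_r1Av4_T*`. Proof shape: the record's corner functions equal the word's literal box (`fin_cases; norm_num`), apply the
word, `norm_num [record, mlEval_vec8]` on both sides, `linarith`. WHAT THIS IS NOT: a new word.
-/

noncomputable section

namespace Summit.Ventures.CertifiedManyBodySolver.Certificates

open Literature.MathematicalPhysics.QuantumLattice Literature.MathematicalPhysics.QuantumLattice.ThermodynamicLimit
open Matrix Finset Filter Topology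
open Literature.MathematicalPhysics.QuantumLattice
open Literature.MathematicalPhysics.QuantumLattice.ThermodynamicLimit
open Literature.MathematicalPhysics.QuantumLattice.TTPrimeFree
open Literature.Probability.LatticeModels
open scoped ComplexOrder ComplexConjugate Topology BigOperators
open Summit.Ventures.CertifiedManyBodySolver.Certificates
open Summit.Ventures.CertifiedManyBodySolver.Certificates.BoxWordGC
open Summit.Ventures.CertifiedManyBodySolver.Certificates.DerivedNTangentR473Sym
open Summit.Ventures.CertifiedManyBodySolver.Certificates.DerivedNTangentR504Sym
open Literature.MathematicalPhysics.QuantumLattice.ClusterLowerBound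
open Set
open Literature.Analysis.ValidatedNumerics (KdCert)
open Literature.Computation.Certificates.BoxCovering
open Literature.Computation.Certificates.BoxCovering
open Literature.Analysis.ValidatedNumerics (KdCert)

/-- Word 430 holds for `e₀`: the landed theorem `cw_Hg1201E_M19P10W_t40_35_H_q1a_mlword_Icc`. -/
theorem kdw_M19_v113_r1Av4_w430_holds (H : kdw_M19_v113_r1Av4_Premises) : kdw_M19_v113_r1Av4_w430.Holds (fun θ : Fin 3 → ℝ => energyDensityTT' 1 (θ 1) (θ 0) (θ 2)) := by
  intro θ hθ
  have eL : (fun k : Fin 3 => ((kdw_M19_v113_r1Av4_w430.lo k : ℚ) : ℝ)) = (![47/5, -2/5, 4/5] : Fin 3 → ℝ) := by funext k; fin_cases k <;> norm_num [kdw_M19_v113_r1Av4_w430]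
  have eH : (fun k : Fin 3 => ((kdw_M19_v113_r1Av4_w430.hi k : ℚ) : ℝ)) = (![51/5, -7/20, 7/8] : Fin 3 → ℝ) := by funext k; fin_cases k <;> norm_num [kdw_M19_v113_r1Av4_w430]
  have hw := Summit.Ventures.CertifiedManyBodySolver.Certificates.cw_Hg1201E_M19P10W_t40_35_H_q1a_mlword_Icc H.hsX17o2m40 H.hsX17o2m30 H.hsX12m40 H.hsX12m30 H.hVL0 H.hVB6 θ (by rw [← eL, ← eH]; exact hθ)
  constructor
  · have h := hw.1; norm_num [kdw_M19_v113_r1Av4_w430, mlEval_vec8] at h ⊢; linarith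
  · have h := hw.2; norm_num [kdw_M19_v113_r1Av4_w430, mlEval_vec8] at h ⊢; linarith

end Summit.Ventures.CertifiedManyBodySolver.Certificates

end
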